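import Summits.AtomisticToContinuum.Crystallization.Theses.MinMeanCycleStackingLock
import Summits.AtomisticToContinuum.Crystallization.Theses.PoissonBesselStacking
import Summits.AtomisticToContinuum.Crystallization.Theses.LuttingerTiszaRegistry

/-!
# Birth skeleton — crux `MinMeanCycleStackingLock.PeriodicReductionToBarlow`

Item `stmt-AtomisticToContinuum-3062` (shared crux, identical signature in the routes
`PoissonBesselStacking` (r2), `LuttingerTiszaRegistry` (r3), `MinMeanCycleStackingLock` (r2)).

The crux: every periodic configuration `Q` of `ℝ³` is matched, at no higher Lennard-Jones energy
per particle, by a UNIFORM Barlow stacking `barlowPeriodicConfiguration s ha hh hp hs` whose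
parameters lie in the relaxation box `B = {47/50 ≤ a ≤ 1, 39/50·a ≤ h ≤ 17/20·a}`.

First cut (two named stubs, both strictly weaker than the crux, neither a restatement of it or of
the sub-problem `Crystallization`):

* `stub_reductionToBarlowFree` — the genuinely three-dimensional content at FREE stacking
  parameters: every periodic `Q` is matched by some uniform Barlow stacking with `0 < a`, `0 < h`
  and a periodic Hägg word `s` (no box). This is "the Barlow family solves the periodic
  Lennard-Jones problem" (local optimality of close packing among all lattice + motif
  configurations, Blanc–Lewin 2015 §2.3; the same residue as `e* = eBarlow` inside
  `Cruxes/ChargedEnergyGap/Lines/barlow_relative_pricing.lean`, `stub_grossFloorPeriodic`).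
  Tools foreseen: twelve-coordination of near-optimal periodic `Q` (Flyspeck-type local
  inequality + LJ bond counting), hole locking of adjacent layers
  (`PoissonBesselStacking.AdjacentLayerHoleLocking`, item 3064), uniformisation of layer spacings
  by convexity. Size XL / open.
* `stub_barlowBoxLocalisation` — BOX LOCALISATION inside the explicit Barlow family: every uniform
  Barlow stacking with arbitrary `a, h > 0` and any periodic Hägg word is matched by one with
  `(a', h') ∈ B`. A two-parameter certified computation over explicit lattice sums: by the PROVED
  `BarlowEnergyIdentification` (item 3065) `e(barlow a h s) = barlowBaseEnergy a h +
  haggEnergy p (J a h) s / p ≥ barlowBaseEnergy a h + Σ_k min (J_k a h) 0`, and this lower bound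
  exceeds `e(hcp a₀ h₀)` for a fixed `(a₀, h₀) ∈ B` on `ℝ₊² ∖ B` (interval arithmetic on a compact
  collar — the LJ optimum `a* ≈ 0.9712`, `h*/a* ≈ 0.8165` sits inside `B` with a 3–4 % margin,
  energy rise ≈ 2e−2 ≫ Σ|J_k| ≈ 1e−4 — plus the asymptotic regions `a, h → 0, ∞`, where an aligned
  layer pair at vertical distance `≤ 3h` or in-layer compression gives `r⁻¹²` blow-up and
  dilution gives energy `→ 0 > e(hcp)`); inside `B` take `(a', h', s') = (a, h, s)`. Size L.

Assembly `PeriodicReductionToBarlow_of`: chain the two comparisons (transitivity of `≤`).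
Sorries: exactly the two stubs; the assembly is sorry-free and concludes the route decl BY NAME
(`MinMeanCycleStackingLock.PeriodicReductionToBarlow`, the primary route of this registration); the
item is SHARED with identical signature, so the same term also closes
`PoissonBesselStacking.PeriodicReductionToBarlow` (`PeriodicReductionToBarlow_ofPBS`,
`PeriodicReductionToBarlow_proof`) and `LuttingerTiszaRegistry.PeriodicReductionToBarlow`
(`PeriodicReductionToBarlow_ofLT`, `PeriodicReductionToBarlow_proofLT`) by definitional unfolding.

Both stubs are CONSEQUENCES of the crux (stub 1 = weakened conclusion; stub 2 = the crux
specialised to `Q` a Barlow stacking), so the cut loses nothing: crux ⟺ stub 1 ∧ stub 2.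
-/

namespace Summit.AtomisticToContinuum.Crystallization.Cruxes.PeriodicReductionToBarlow.Birth

/-- **Stub 1 — reduction to a uniform Barlow stacking at free parameters** (the 3-D content):
for every periodic configuration `Q` of `ℝ³` there are `a, h > 0` and a `p`-periodic Hägg word `s`
such that the uniform Barlow stacking `barlowPeriodicConfiguration s` at `(a, h)` has Lennard-Jones
energy per particle `≤` that of `Q`. Strictly weaker than the crux (no box); open
(Blanc–Lewin 2015 §2.3). -/
theorem stub_reductionToBarlowFree : ∀ Q : Literature.MathematicalPhysics.StatisticalMechanics.PeriodicConfiguration 3, ∃ a h : ℝ, 0 < a ∧ 0 < h ∧ ∃ (s : ℤ → ℤ) (p : ℕ) (ha : a ≠ 0) (hh : h ≠ 0) (hp : p ≠ 0) (hs : ∀ i, s (i + p) = s i), Literature.MathematicalPhysics.StatisticalMechanics.IsHaggSeq s ∧ (Literature.MathematicalPhysics.StatisticalMechanics.barlowPeriodicConfiguration s ha hh hp hs).energyPerParticle Literature.MathematicalPhysics.StatisticalMechanics.lennardJones ≤ Q.energyPerParticle Literature.MathematicalPhysics.StatisticalMechanics.lennardJones := by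
  sorry

/-- **Stub 2 — box localisation inside the Barlow family** (certified two-parameter
computation): every uniform Barlow stacking with `a, h > 0` and a periodic Hägg word `s` is
matched, at no higher Lennard-Jones energy per particle, by a uniform Barlow stacking with
parameters in `B = {47/50 ≤ a' ≤ 1, 39/50·a' ≤ h' ≤ 17/20·a'}`. Strictly weaker than the crux
(only Barlow competitors); true iff the LJ optimum of the Barlow family is approached inside `B`
(numerics: relaxed hcp, `a* ≈ 0.9712`, `h* ≈ 0.7930`). -/
theorem stub_barlowBoxLocalisation : ∀ a h : ℝ, 0 < a → 0 < h → ∀ (s : ℤ → ℤ) (p : ℕ) (ha : a ≠ 0) (hh : h ≠ 0) (hp : p ≠ 0) (hs : ∀ i, s (i + p) = s i), Literature.MathematicalPhysics.StatisticalMechanics.IsHaggSeq s → ∃ a' h' : ℝ, 47 / 50 ≤ a' ∧ a' ≤ 1 ∧ 39 / 50 * a' ≤ h' ∧ h' ≤ 17 / 20 * a' ∧ ∃ (s' : ℤ → ℤ) (p' : ℕ) (ha' : a' ≠ 0) (hh' : h' ≠ 0) (hp' : p' ≠ 0) (hs' : ∀ i, s' (i + p') = s' i), Literature.MathematicalPhysics.StatisticalMechanics.IsHaggSeq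 s' ∧ (Literature.MathematicalPhysics.StatisticalMechanics.barlowPeriodicConfiguration s' ha' hh' hp' hs').energyPerParticle Literature.MathematicalPhysics.StatisticalMechanics.lennardJones ≤ (Literature.MathematicalPhysics.StatisticalMechanics.barlowPeriodicConfiguration s ha hh hp hs).energyPerParticle Literature.MathematicalPhysics.StatisticalMechanics.lennardJones := by
  sorry

/-- **Assembly**: stub 1 → stub 2 → the crux, by chaining the two energy comparisons. Concludes
the route decl `MinMeanCycleStackingLock.PeriodicReductionToBarlow` by name; no `sorry`. -/
theorem PeriodicReductionToBarlow_of : (∀ Q : Literature.MathematicalPhysics.StatisticalMechanics.PeriodicConfiguration 3, ∃ a h : ℝ, 0 < a ∧ 0 < h ∧ ∃ (s : ℤ → ℤ) (p : ℕ) (ha : a ≠ 0) (hh : h ≠ 0) (hp : p ≠ 0) (hs : ∀ i, s (i + p) = s i), Literature.MathematicalPhysics.StatisticalMechanics.IsHaggSeq s ∧ (Literature.MathematicalPhysics.StatisticalMechanics.barlowPeriodicConfiguration s ha hh hp hs).energyPerParticle Literature.MathematicalPhysics.StatisticalMechanics.lennardJones ≤ Q.energyPerParticle Literature.MathematicalPhysics.StatisticalMechanics.lennardJones)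 → (∀ a h : ℝ, 0 < a → 0 < h → ∀ (s : ℤ → ℤ) (p : ℕ) (ha : a ≠ 0) (hh : h ≠ 0) (hp : p ≠ 0) (hs : ∀ i, s (i + p) = s i), Literature.MathematicalPhysics.StatisticalMechanics.IsHaggSeq s → ∃ a' h' : ℝ, 47 / 50 ≤ a' ∧ a' ≤ 1 ∧ 39 / 50 * a' ≤ h' ∧ h' ≤ 17 / 20 * a' ∧ ∃ (s' : ℤ → ℤ) (p' : ℕ) (ha' : a' ≠ 0) (hh' : h' ≠ 0) (hp' : p' ≠ 0) (hs' : ∀ i, s' (i + p') = s' i), Literature.MathematicalPhysics.StatisticalMechanics.IsHaggSeq s' ∧ (Literature.MathematicalPhysics.StatisticalMechanics.barlowPeriodicConfiguration s' ha' hh' hp' hs').energyPerParticle Literature.MathematicalPhysics.StatisticalMechanics.lennardJones ≤ (Literature.MathematicalPhysics.StatisticalMechanics.barlowPeriodicConfiguration s ha hh hp hs).energyPerParticle Literature.MathematicalPhysics.StatisticalMechanics.lennardJones) → Summit.AtomisticToContinuum.Crystallization.Theses.MinMeanCycleStackingLock.PeriodicReductionToBarlow := by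
  intro hFree hBox Q
  obtain ⟨a, h, ha0, hh0, s, p, ha, hh, hp, hs, hsH, hle⟩ := hFree Q
  obtain ⟨a', h', hb₁, hb₂, hb₃, hb₄, s', p', ha', hh', hp', hs', hsH', hle'⟩ :=
    hBox a h ha0 hh0 s p ha hh hp hs hsH
  exact ⟨a', h', hb₁, hb₂, hb₃, hb₄, s', p', ha', hh', hp', hs', hsH', hle'.trans hle⟩

/-- The assembly instantiated with the two stubs: the crux, modulo exactly the two `sorry`s. -/
theorem PeriodicReductionToBarlow_skeleton : Summit.AtomisticToContinuum.Crystallization.Theses.MinMeanCycleStackingLock.PeriodicReductionToBarlow :=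
  PeriodicReductionToBarlow_of stub_reductionToBarlowFree stub_barlowBoxLocalisation

/-! ### The shared copies of the crux (identical signatures; definitional unfolding) -/

/-- Same assembly, concluding the `PoissonBesselStacking` copy of the shared item 3062. -/
theorem PeriodicReductionToBarlow_ofPBS : (∀ Q : Literature.MathematicalPhysics.StatisticalMechanics.PeriodicConfiguration 3, ∃ a h : ℝ, 0 < a ∧ 0 < h ∧ ∃ (s : ℤ → ℤ) (p : ℕ) (ha : a ≠ 0) (hh : h ≠ 0) (hp : p ≠ 0) (hs : ∀ i, s (i + p) = s i), Literature.MathematicalPhysics.StatisticalMechanics.IsHaggSeq s ∧ (Literature.MathematicalPhysics.StatisticalMechanics.barlowPeriodicConfiguration s ha hh hp hs).energyPerParticle Literature.MathematicalPhysics.StatisticalMechanics.lennardJones ≤ Q.energyPerParticle Literature.MathematicalPhysics.StatisticalMechanics.lennardJones) → (∀ a h : ℝ, 0 < a → 0 < h → ∀ (s : ℤ → ℤ) (p : ℕ) (ha : a ≠ 0) (hh : h ≠ 0) (hp : p ≠ 0) (hs : ∀ i, s (i + p) = s i), Literature.MathematicalPhysics.StatisticalMechanics.IsHaggSeq s → ∃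 a' h' : ℝ, 47 / 50 ≤ a' ∧ a' ≤ 1 ∧ 39 / 50 * a' ≤ h' ∧ h' ≤ 17 / 20 * a' ∧ ∃ (s' : ℤ → ℤ) (p' : ℕ) (ha' : a' ≠ 0) (hh' : h' ≠ 0) (hp' : p' ≠ 0) (hs' : ∀ i, s' (i + p') = s' i), Literature.MathematicalPhysics.StatisticalMechanics.IsHaggSeq s' ∧ (Literature.MathematicalPhysics.StatisticalMechanics.barlowPeriodicConfiguration s' ha' hh' hp' hs').energyPerParticle Literature.MathematicalPhysics.StatisticalMechanics.lennardJones ≤ (Literature.MathematicalPhysics.StatisticalMechanics.barlowPeriodicConfiguration s ha hh hp hs).energyPerParticle Literature.MathematicalPhysics.StatisticalMechanics.lennardJones) → Summit.AtomisticToContinuum.Crystallization.Theses.PoissonBesselStacking.PeriodicReductionToBarlow :=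
  fun hFree hBox => PeriodicReductionToBarlow_of hFree hBox

/-- The `PoissonBesselStacking` copy, modulo the two stubs (the item's default crux decl). -/
theorem PeriodicReductionToBarlow_proof : Summit.AtomisticToContinuum.Crystallization.Theses.PoissonBesselStacking.PeriodicReductionToBarlow :=
  PeriodicReductionToBarlow_ofPBS stub_reductionToBarlowFree stub_barlowBoxLocalisation

/-- Same assembly, concluding the `LuttingerTiszaRegistry` copy of the shared item 3062. -/
theorem PeriodicReductionToBarlow_ofLT : (∀ Q : Literature.MathematicalPhysics.StatisticalMechanics.PeriodicConfiguration 3, ∃ a h : ℝ, 0 < a ∧ 0 < h ∧ ∃ (s : ℤ → ℤ) (p : ℕ) (ha : a ≠ 0) (hh : h ≠ 0) (hp : p ≠ 0) (hs : ∀ i, s (i + p) = s i), Literature.MathematicalPhysics.StatisticalMechanics.IsHaggSeq s ∧ (Literature.MathematicalPhysics.StatisticalMechanics.barlowPeriodicConfiguration s ha hh hp hs).energyPerParticle Literature.MathematicalPhysics.StatisticalMechanics.lennardJones ≤ Q.energyPerParticle Literature.MathematicalPhysics.StatisticalMechanics.lennardJones) → (∀ a h : ℝ, 0 < a → 0 <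 h → ∀ (s : ℤ → ℤ) (p : ℕ) (ha : a ≠ 0) (hh : h ≠ 0) (hp : p ≠ 0) (hs : ∀ i, s (i + p) = s i), Literature.MathematicalPhysics.StatisticalMechanics.IsHaggSeq s → ∃ a' h' : ℝ, 47 / 50 ≤ a' ∧ a' ≤ 1 ∧ 39 / 50 * a' ≤ h' ∧ h' ≤ 17 / 20 * a' ∧ ∃ (s' : ℤ → ℤ) (p' : ℕ) (ha' : a' ≠ 0) (hh' : h' ≠ 0) (hp' : p' ≠ 0) (hs' : ∀ i, s' (i + p') = s' i), Literature.MathematicalPhysics.StatisticalMechanics.IsHaggSeq s' ∧ (Literature.MathematicalPhysics.StatisticalMechanics.barlowPeriodicConfiguration s' ha' hh' hp' hs').energyPerParticle Literature.MathematicalPhysics.StatisticalMechanics.lennardJones ≤ (Literature.MathematicalPhysics.StatisticalMechanics.barlowPeriodicConfiguration s ha hh hp hs).energyPerParticle Literature.MathematicalPhysics.StatisticalMechanics.lennardJones) → Summit.AtomisticToContinuum.Crystallization.Theses.LuttingerTiszaRegistry.PeriodicReductionToBarlow :=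
  fun hFree hBox => PeriodicReductionToBarlow_of hFree hBox

/-- The `LuttingerTiszaRegistry` copy, modulo the two stubs. -/
theorem PeriodicReductionToBarlow_proofLT : Summit.AtomisticToContinuum.Crystallization.Theses.LuttingerTiszaRegistry.PeriodicReductionToBarlow :=
  PeriodicReductionToBarlow_ofLT stub_reductionToBarlowFree stub_barlowBoxLocalisation

end Summit.AtomisticToContinuum.Crystallization.Cruxes.PeriodicReductionToBarlow.Birth
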